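import Mathlib
import Summits.CriticalPhenomena.SAWScalingLimit.Theorems.SAWDefectDecoherenceObservableToSLERGateTransferCrosscut

/-!
# Gate transfer, topology 3: the two sides of the cut — same-side segments, the small side

Support file for the stub `stub_gateTransfer` (the gate transfer
`GateDecomposition → RenewalAccumulation → CarvedToSLE → HexTight → FullIdentification`) of the
line `bridge-gate-renewal` for the crux
`Summit.CriticalPhenomena.SAWScalingLimit.Theses.SAWDefectDecoherence.ObservableToSLER`
(item `stmt-CriticalPhenomena-14005`).

Consequences of `exists_two_sides_of_convex` for the component ("side") of a point of `D ∖ cut`: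
* `subset_closedBall_of_frontier_subset` — a bounded open set whose frontier lies in a closed
  ball lies in it (ray argument);
* `mem_connectedComponentIn_of_segment` — points of `D ∩ K°` joined by a segment of `D̄` lie on
  the same side;
* `connectedComponentIn_eq_of_two_sides`, `cut_subset_closure_connectedComponentIn` — a side
  is one of `U₁`, `U₂`; the cut lies in the closure of each side;
* `connectedComponentIn_subset_closedBall` (registered sub-goal `stub_sideInBall`) — if the
  boundary points in `K` cut off short arcs and a far point lies on the other side, the side is
  small.  Elementary given Newman's theorem; tagged [folklore].
-/

noncomputable section

open scoped BigOperators Topology NNReal ENNReal Classical BoundedContinuousFunction unitInterval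
open Filter Set MeasureTheory Metric

namespace Summit.CriticalPhenomena.SAWScalingLimit.Theorems.ObservableToSLER.BridgeGate

open Literature.Probability.RandomPlanarGeometry (JordanDomain)

section Sides

variable (D : JordanDomain) {K : Set ℂ} {g z₁ z₂ : ℂ}

/-- **A bounded open set whose frontier lies in a closed ball lies in that ball** (ray
argument). -/
theorem subset_closedBall_of_frontier_subset {W : Set ℂ} (hWo : IsOpen W)
    (hWb : Bornology.IsBounded W) {z₀ : ℂ} {ρ : ℝ} (hρ : 0 ≤ ρ) (hW : frontier W ⊆ closedBall z₀ ρ) :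
    W ⊆ closedBall z₀ ρ := by
  intro x hx
  by_contra hxρ
  rw [mem_closedBall, not_le] at hxρ
  set d : ℂ := x - z₀ with hd
  have hxd : dist x z₀ = ‖d‖ := by rw [hd, dist_eq_norm]
  have hd0 : 0 < ‖d‖ := by rw [← hxd]; linarith
  obtain ⟨M, hM⟩ := hWb.subset_ball z₀
  set T : ℝ := max 0 (M / ‖d‖) with hT
  have hT0 : 0 ≤ T := le_max_left _ _
  set f : ℝ → ℂ := fun τ => x + (τ : ℂ) * d with hf
  have hfc : Continuous f := by simp only [hf]; fun_prop
  have hfdist : ∀ τ : ℝ, 0 ≤ τ → dist (f τ) z₀ = (1 + τ) * ‖d‖ := by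
    intro τ hτ
    rw [dist_eq_norm, hf]
    simp only
    rw [show x + (τ : ℂ) * d - z₀ = ((1 + τ : ℝ) : ℂ) * d by rw [hd]; push_cast; ring, norm_mul,
      Complex.norm_real, Real.norm_eq_abs, abs_of_nonneg (by linarith)]
  have hfT : f T ∉ W := by
    intro h
    have := hM h
    rw [mem_ball, hfdist T hT0] at this
    have h2 : M / ‖d‖ ≤ T := le_max_right _ _
    rw [div_le_iff₀ hd0] at h2
    nlinarith
  -- the segment `f '' [0, T]` is connected, starts in `W`, and avoids `frontier W`
  set S : Set ℂ := f '' Icc 0 T with hS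
  have hSc : IsPreconnected S := (isPreconnected_Icc).image f hfc.continuousOn
  have hSW : (S ∩ W).Nonempty := ⟨x, ⟨0, ⟨le_rfl, hT0⟩, by simp [hf]⟩, hx⟩
  have hSfr : ∀ z ∈ S, z ∉ frontier W := by
    rintro _ ⟨τ, hτ, rfl⟩ hz
    have := hW hz
    rw [mem_closedBall, hfdist τ hτ.1] at this
    have h2 : ‖d‖ ≤ (1 + τ) * ‖d‖ := by nlinarith [hτ.1]
    linarith
  have hsub : S ⊆ W := hSc.subset_of_closure_inter_subset hWo hSW (by
    rintro z ⟨hzc, hzS⟩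
    rw [closure_eq_self_union_frontier] at hzc
    exact hzc.resolve_right (hSfr z hzS))
  exact hfT (hsub ⟨T, ⟨hT0, le_rfl⟩, rfl⟩)

/-- **Points joined by a segment of `D̄` inside the interior of `K` lie on the same side of the
cut.** -/
theorem mem_connectedComponentIn_of_segment (hKc : Convex ℝ K) (hKi : (interior K).Nonempty)
    (hKb : Bornology.IsBounded K) (hgK : g ∈ frontier K) (hgD : g ∈ D.carrier)
    (hz₁ : z₁ ∈ frontier K) (hz₁D : z₁ ∉ D.carrier) (hz₂ : z₂ ∈ frontier K) (hz₂D : z₂ ∉ D.carrier)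
    (hne : z₁ ≠ z₂) {cut : Set ℂ} (hcut : cut = connectedComponentIn (frontier K ∩ D.carrier) g)
    {x y : ℂ} (hx : x ∈ D.carrier) (hy : y ∈ D.carrier) (hxK : x ∈ interior K)
    (hyK : y ∈ interior K) (hseg : segment ℝ x y ⊆ closure D.carrier) :
    y ∈ connectedComponentIn (D.carrier \ cut) x := by
  obtain ⟨U₁, U₂, s, t, hU₁o, hU₂o, hU₁c, hU₂c, hdisj, hunion, -, -, -, -, -, -, hcutK, hcov,
    hinter⟩ := exists_two_sides_of_convex D hKc hKi hKb hgK hgD hz₁ hz₁D hz₂ hz₂D hne hcut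
  have hnotcut : ∀ {w : ℂ}, w ∈ interior K → w ∉ cut := fun hw hwc =>
    Set.disjoint_left.1 disjoint_interior_frontier hw (hcutK (subset_closure hwc))
  have hx' : x ∈ U₁ ∪ U₂ := hunion ▸ ⟨hx, hnotcut hxK⟩
  have hy' : y ∈ U₁ ∪ U₂ := hunion ▸ ⟨hy, hnotcut hyK⟩
  -- same side: the side is connected inside `D ∖ cut`
  have same : ∀ {V : Set ℂ}, IsConnected V → V ⊆ D.carrier \ cut → x ∈ V → y ∈ V →
      y ∈ connectedComponentIn (D.carrier \ cut) x :=
    fun hV hVs hxV hyV => hV.isPreconnected.subset_connectedComponentIn hxV hVs hyV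
  -- opposite sides are impossible: the segment would cross `closure cut ⊆ frontier K`
  have opp : ∀ {V W : Set ℂ}, closure D.carrier ⊆ closure V ∪ closure W →
      closure V ∩ closure W ⊆ closure cut → x ∈ V → y ∈ W → False := by
    intro V W hcov' hinter' hxV hyW
    have hseg' : segment ℝ x y ⊆ closure V ∪ closure W := hseg.trans hcov'
    obtain ⟨z, hzs, hzV, hzW⟩ := isPreconnected_closed_iff.1 (convex_segment x y).isPreconnected
      _ _ isClosed_closure isClosed_closure hseg' ⟨x, left_mem_segment ℝ x y, subset_closure hxV⟩
      ⟨y, right_mem_segment ℝ x y, subset_closure hyW⟩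
    have hzK : z ∈ interior K := hKc.interior.segment_subset hxK hyK hzs
    exact Set.disjoint_left.1 disjoint_interior_frontier hzK (hcutK (hinter' ⟨hzV, hzW⟩))
  have hU₁s : U₁ ⊆ D.carrier \ cut := hunion ▸ subset_union_left
  have hU₂s : U₂ ⊆ D.carrier \ cut := hunion ▸ subset_union_right
  rcases hx' with hx' | hx' <;> rcases hy' with hy' | hy'
  · exact same hU₁c hU₁s hx' hy'
  · exact (opp hcov hinter hx' hy').elim
  · exact (opp (by rwa [union_comm]) (by rwa [inter_comm]) hx' hy').elim
  · exact same hU₂c hU₂s hx' hy'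

/-- The component of a point of `D ∖ cut` is one of the two sides. -/
theorem connectedComponentIn_eq_of_two_sides {U₁ U₂ cut : Set ℂ} (hU₁o : IsOpen U₁) (hU₂o : IsOpen U₂)
    (hU₁c : IsConnected U₁) (hU₂c : IsConnected U₂) (hdisj : Disjoint U₁ U₂)
    (hunion : U₁ ∪ U₂ = D.carrier \ cut) {x : ℂ} (hx : x ∈ D.carrier \ cut) :
    (x ∈ U₁ ∧ connectedComponentIn (D.carrier \ cut) x = U₁) ∨
      (x ∈ U₂ ∧ connectedComponentIn (D.carrier \ cut) x = U₂) := by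
  have hpre : IsPreconnected (connectedComponentIn (D.carrier \ cut) x) :=
    isPreconnected_connectedComponentIn
  have hsub : connectedComponentIn (D.carrier \ cut) x ⊆ U₁ ∪ U₂ :=
    hunion ▸ connectedComponentIn_subset _ _
  have hxm : x ∈ connectedComponentIn (D.carrier \ cut) x := mem_connectedComponentIn hx
  rw [← hunion] at hx
  rcases hx with hx | hx
  · left
    refine ⟨hx, Subset.antisymm (hpre.subset_left_of_subset_union hU₁o hU₂o hdisj hsub ⟨x, hxm, hx⟩)
      (hU₁c.isPreconnected.subset_connectedComponentIn hx (hunion ▸ subset_union_left))⟩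
  · right
    refine ⟨hx, Subset.antisymm (hpre.subset_right_of_subset_union hU₁o hU₂o hdisj hsub ⟨x, hxm, hx⟩)
      (hU₂c.isPreconnected.subset_connectedComponentIn hx (hunion ▸ subset_union_right))⟩

/-- **The cut lies in the closure of each side** (Newman: the cut is in the frontier of both
components). -/
theorem cut_subset_closure_connectedComponentIn (hKc : Convex ℝ K) (hKi : (interior K).Nonempty)
    (hKb : Bornology.IsBounded K) (hgK : g ∈ frontier K) (hgD : g ∈ D.carrier)
    (hz₁ : z₁ ∈ frontier K) (hz₁D : z₁ ∉ D.carrier) (hz₂ : z₂ ∈ frontier K) (hz₂D : z₂ ∉ D.carrier)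
    (hne : z₁ ≠ z₂) {cut : Set ℂ} (hcut : cut = connectedComponentIn (frontier K ∩ D.carrier) g)
    {x : ℂ} (hx : x ∈ D.carrier \ cut) :
    cut ⊆ closure (connectedComponentIn (D.carrier \ cut) x) := by
  obtain ⟨U₁, U₂, s, t, hU₁o, hU₂o, hU₁c, hU₂c, hdisj, hunion, -, -, hf₁, hf₂, -⟩ :=
    exists_two_sides_of_convex D hKc hKi hKb hgK hgD hz₁ hz₁D hz₂ hz₂D hne hcut
  rcases connectedComponentIn_eq_of_two_sides D hU₁o hU₂o hU₁c hU₂c hdisj hunion hx with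
    ⟨-, h⟩ | ⟨-, h⟩ <;> rw [h, closure_eq_self_union_frontier]
  · rw [hf₁]; exact fun z hz => Or.inr (Or.inl (subset_closure hz))
  · rw [hf₂]; exact fun z hz => Or.inr (Or.inl (subset_closure hz))

/-- **The side not containing a far point is small.**  If `K ⊆ B̄(z₀, ρ₁)` (closed), every pair
of boundary points of `D` in `K` cuts off an arc of `∂D` that stays `η`-close to its start, and
`y ∈ D ∖ cut` lies on the other side of the cut from `x` at distance `> ρ₁ + η` from `z₀`, then
the side of `x` lies in `B̄(z₀, ρ₁ + η)`. -/
theorem connectedComponentIn_subset_closedBall (hKc : Convex ℝ K) (hKi : (interior K).Nonempty)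
    (hKb : Bornology.IsBounded K) (hKcl : IsClosed K) (hgK : g ∈ frontier K) (hgD : g ∈ D.carrier)
    (hz₁ : z₁ ∈ frontier K) (hz₁D : z₁ ∉ D.carrier) (hz₂ : z₂ ∈ frontier K) (hz₂D : z₂ ∉ D.carrier)
    (hne : z₁ ≠ z₂) {cut : Set ℂ} (hcut : cut = connectedComponentIn (frontier K ∩ D.carrier) g)
    {z₀ : ℂ} {ρ₁ η : ℝ} (hη : 0 ≤ η) (hK : K ⊆ closedBall z₀ ρ₁)
    (harc : ∀ s t : ℝ, s < t → t < s + 1 → D.boundary s ∈ K → D.boundary t ∈ K →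
      (∀ u ∈ Icc s t, dist (D.boundary u) (D.boundary s) < η) ∨
      (∀ u ∈ Icc t (s + 1), dist (D.boundary u) (D.boundary s) < η))
    {x y : ℂ} (hx : x ∈ D.carrier \ cut) (hy : y ∈ D.carrier \ cut)
    (hyx : y ∉ connectedComponentIn (D.carrier \ cut) x) (hyfar : ρ₁ + η < dist y z₀) :
    connectedComponentIn (D.carrier \ cut) x ⊆ closedBall z₀ (ρ₁ + η) := by
  obtain ⟨U₁, U₂, s, t, hU₁o, hU₂o, hU₁c, hU₂c, hdisj, hunion, hst, hts, hf₁, hf₂, hsc, htc, hcutK,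
    -, -⟩ := exists_two_sides_of_convex D hKc hKi hKb hgK hgD hz₁ hz₁D hz₂ hz₂D hne hcut
  have hclK : closure cut ⊆ K := hcutK.trans hKcl.frontier_subset
  have hsK : D.boundary s ∈ K := hclK hsc
  have htK : D.boundary t ∈ K := hclK htc
  have hclB : closure cut ⊆ closedBall z₀ (ρ₁ + η) :=
    hclK.trans (hK.trans (closedBall_subset_closedBall (by linarith)))
  have hsB : dist (D.boundary s) z₀ ≤ ρ₁ := hK hsK
  have hρη : 0 ≤ ρ₁ + η := by linarith [dist_nonneg (x := D.boundary s) (y := z₀)]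
  -- the short arc lies in the big ball
  have harcB : ∀ {J : Set ℝ}, (∀ u ∈ J, dist (D.boundary u) (D.boundary s) < η) →
      D.boundary '' J ⊆ closedBall z₀ (ρ₁ + η) := by
    rintro J hJ _ ⟨u, hu, rfl⟩
    rw [mem_closedBall]
    linarith [dist_triangle (D.boundary u) (D.boundary s) z₀, hJ u hu]
  have hU₁b : Bornology.IsBounded U₁ :=
    D.isBounded.subset ((hunion ▸ subset_union_left).trans sdiff_subset)
  have hU₂b : Bornology.IsBounded U₂ :=
    D.isBounded.subset ((hunion ▸ subset_union_right).trans sdiff_subset)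
  have hy' := connectedComponentIn_eq_of_two_sides D hU₁o hU₂o hU₁c hU₂c hdisj hunion hy
  rcases connectedComponentIn_eq_of_two_sides D hU₁o hU₂o hU₁c hU₂c hdisj hunion hx with
    ⟨hxU, hcomp⟩ | ⟨hxU, hcomp⟩ <;> rw [hcomp] at hyx ⊢
  · -- `x ∈ U₁`, `y ∈ U₂`
    have hyU₂ : y ∈ U₂ := by
      rcases hy' with ⟨h, -⟩ | ⟨h, -⟩
      · exact absurd h hyx
      · exact h
    rcases harc s t hst hts hsK htK with h | h
    · exact subset_closedBall_of_frontier_subset hU₁o hU₁b hρη (hf₁ ▸ union_subset hclB (harcB h))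
    · have hU₂B := subset_closedBall_of_frontier_subset hU₂o hU₂b hρη (hf₂ ▸ union_subset hclB (harcB h))
      have := hU₂B hyU₂
      rw [mem_closedBall] at this
      linarith
  · -- `x ∈ U₂`, `y ∈ U₁`
    have hyU₁ : y ∈ U₁ := by
      rcases hy' with ⟨h, -⟩ | ⟨h, -⟩
      · exact h
      · exact absurd h hyx
    rcases harc s t hst hts hsK htK with h | h
    · have hU₁B := subset_closedBall_of_frontier_subset hU₁o hU₁b hρη (hf₁ ▸ union_subset hclB (harcB h))
      have := hU₁B hyU₁
      rw [mem_closedBall] at this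
      linarith
    · exact subset_closedBall_of_frontier_subset hU₂o hU₂b hρη (hf₂ ▸ union_subset hclB (harcB h))

end Sides

end Summit.CriticalPhenomena.SAWScalingLimit.Theorems.ObservableToSLER.BridgeGate

namespace Summit.CriticalPhenomena.SAWScalingLimit.Theorems.ObservableToSLER.BridgeGate

open Literature.Probability.RandomPlanarGeometry (JordanDomain)

/-- **Registered sub-goal `stub_sideInBall`** (self-contained form of `connectedComponentIn_subset_closedBall`). -/
theorem stub_sideInBall : ∀ (D : Literature.Probability.RandomPlanarGeometry.JordanDomain) (K : Set ℂ) (g z₁ z₂ z₀ x y : ℂ) (ρ₁ η : ℝ), Convex ℝ K → (interior K).Nonempty → Bornology.IsBounded K → IsClosed K → g ∈ frontier K → g ∈ D.carrier → z₁ ∈ frontier K → z₁ ∉ D.carrier → z₂ ∈ frontier K → z₂ ∉ D.carrier → z₁ ≠ z₂ → 0 ≤ η → K ⊆ Metric.closedBall z₀ ρ₁ → (∀ s t : ℝ, s < t → t < s + 1 → D.boundary s ∈ K → D.boundary t ∈ K → (∀ u ∈ Set.Icc s t, dist (D.boundary u) (D.boundary s) < η) ∨ (∀ u ∈ Set.Icc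 t (s + 1), dist (D.boundary u) (D.boundary s) < η)) → x ∈ D.carrier \ connectedComponentIn (frontier K ∩ D.carrier) g → y ∈ D.carrier \ connectedComponentIn (frontier K ∩ D.carrier) g → y ∉ connectedComponentIn (D.carrier \ connectedComponentIn (frontier K ∩ D.carrier) g) x → ρ₁ + η < dist y z₀ → connectedComponentIn (D.carrier \ connectedComponentIn (frontier K ∩ D.carrier) g) x ⊆ Metric.closedBall z₀ (ρ₁ + η) :=
  fun D _ _ _ _ _ _ _ _ _ hKc hKi hKb hKcl hgK hgD hz₁ hz₁D hz₂ hz₂D hne hη hK harc hx hy hyx hyfar =>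
    connectedComponentIn_subset_closedBall D hKc hKi hKb hKcl hgK hgD hz₁ hz₁D hz₂ hz₂D hne rfl hη hK harc
      hx hy hyx hyfar

end Summit.CriticalPhenomena.SAWScalingLimit.Theorems.ObservableToSLER.BridgeGate

end
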